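import Summits.Ventures.YMGap.Thresholds.CouplingDerivativeTools
import Summits.Ventures.YMGap.Thresholds.LinearResponseBound
import HarnessLib

/-!
# Venture YMGap — tools for C-SMOOTH: the pigeonhole cut among integer distances, finite products of bounded Lipschitz
# cylinders, geometric plaquette sums, and re-indexing of tuple series

HONEST FRAMING: venture file of the cell `pub-ymgap` (QuantumFields programme), seat ds-1 (gen 12).  Elementary bookkeeping
(combinatorics on `ℕ`, Lipschitz cylinders of `SU(N)` gauge fields on `ℤ^d`, geometric lattice sums on `ℤ⁴`, `tsum` over tuples);
no coupling, no state, no number; nothing about the continuum or the Clay problem.  Consumed by `TruncatedSplit`,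
`TruncatedTreeDecay`, `CouplingSmooth` and their `SU(N)` twins (object C-SMOOTH: all-orders tree decay of the truncated
functions ⇒ `C^∞` of the strong-coupling state and free energy).

* `exists_gap_aux` / `exists_gap` — PIGEONHOLE: among `n` integer distances `d_i ≤ R = max d_i > 0` (and `0`) there is an
  empty gap `(u, v)`, `u < v ≤ R`, with `R ≤ n (v − u)`;
* `isLipschitzCylinder_prod` — finite products of bounded Lipschitz cylinders (uniform constant `K₀`, bound `B₀ ≥ 1`) are
  Lipschitz cylinders on the union of the supports, constant `|T| K₀ B₀^{|T|}`, bound `B₀^{|T|}`;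
* `prod_exp_neg_pow_eq` — `∏_i (e^{−c})^{ℓ_i} = exp(−c Σ_i ℓ_i)`; `sum_pow_l1_plaquette_le` — finite sums of `ρ^{‖x₀ − x_r‖₁}`
  over plaquettes of `ℤ⁴` are `≤ D₄((1+ρ)/(1−ρ))⁴` (rb-p1's `summable_and_tsum_base_le`);
* `tsum_snoc_eq` — `Σ'_{q' : Fin (n+1) → P} f q' = Σ'_{q : Fin n → P} Σ'_r f (snoc q r)` for summable `f`.
-/

noncomputable section

open MeasureTheory ProbabilityTheory Function Finset Filter Topology Real Set
open scoped NNReal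
open Literature.MathematicalPhysics.QuantumLattice (LGConfig ZdEdge ZdPlaquette plaquetteEdges fundamentalRep)
open Literature.MathematicalPhysics.QuantumFieldTheory hiding ZdEdge
open Literature.Probability.LatticeModels (Site)
open Summit.Ventures.YMGap.RobustBall (l1 numOrient)
open Summit.Ventures.YMGap.LinearResponseBound (summable_and_tsum_base_le)

namespace Summit.Ventures.YMGap.CouplingResponse

/-! ### §1 Pigeonhole: an empty gap among the distances -/

/-- **Pigeonhole on the line**: a set `V` of `k + 1` natural numbers containing `0`, with maximum `R > 0`, has two
members `u < v ≤ R` with nothing of `V` strictly between them and `R ≤ k (v − u)`. [folklore] -/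
theorem exists_gap_aux : ∀ (k : ℕ) (V : Finset ℕ) (R : ℕ), V.card = k + 1 → 0 ∈ V → R ∈ V → (∀ x ∈ V, x ≤ R) →
    0 < R → ∃ u v : ℕ, u < v ∧ v ≤ R ∧ R ≤ k * (v - u) ∧ ∀ x ∈ V, x ≤ u ∨ v ≤ x := by
  intro k
  induction k with
  | zero =>
    intro V R hcard h0 hR _ hpos
    obtain ⟨x, hx⟩ := Finset.card_eq_one.1 hcard
    have h0' : (0 : ℕ) = x := by simpa [hx] using h0
    have hR' : R = x := by simpa [hx] using hR
    omega
  | succ k ih =>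
    intro V R hcard h0 hR hmax hpos
    set V' := V.erase R with hV'
    have hcard' : V'.card = k + 1 := by rw [hV', Finset.card_erase_of_mem hR, hcard]; rfl
    have h0' : 0 ∈ V' := Finset.mem_erase.2 ⟨by omega, h0⟩
    have hne : V'.Nonempty := ⟨0, h0'⟩
    set R' := V'.max' hne with hR'def
    have hR'mem : R' ∈ V' := Finset.max'_mem _ _
    have hmax' : ∀ x ∈ V', x ≤ R' := fun x hx => Finset.le_max' _ _ hx
    have hR'lt : R' < R := by
      obtain ⟨hne', hRV⟩ := Finset.mem_erase.1 hR'mem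
      exact lt_of_le_of_ne (hmax R' hRV) hne'
    by_cases hc : R ≤ (k + 1) * (R - R')
    · refine ⟨R', R, hR'lt, le_rfl, hc, fun x hx => ?_⟩
      by_cases hxR : x = R
      · exact Or.inr hxR.ge
      · exact Or.inl (hmax' x (Finset.mem_erase.2 ⟨hxR, hx⟩))
    · rw [not_le] at hc
      have hR'pos : 0 < R' := by
        by_contra h
        have : R' = 0 := by omega
        rw [this, Nat.sub_zero] at hc
        nlinarith
      obtain ⟨u, v, huv, hvR', hgap, hall⟩ := ih V' R' hcard' h0' hR'mem hmax' hR'pos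
      refine ⟨u, v, huv, hvR'.trans hR'lt.le, ?_, fun x hx => ?_⟩
      · -- `k R < (k+1) R' ≤ (k+1) k (v-u)` forces `k ≥ 1` and `R < (k+1)(v-u)`
        have hk : 0 < k := by
          by_contra h
          have hk0 : k = 0 := by omega
          rw [hk0, zero_mul] at hgap
          omega
        have h1 : k * R < (k + 1) * R' := by
          have : (k + 1) * (R - R') < R := hc
          have e : (k + 1) * (R - R') = (k + 1) * R - (k + 1) * R' := Nat.mul_sub _ _ _
          have e2 : (k + 1) * R = k * R + R := by ring
          have e3 : (k + 1) * R' ≤ (k + 1) * R := Nat.mul_le_mul_left _ hR'lt.le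
          omega
        have h2 : k * R < k * ((k + 1) * (v - u)) := by
          calc k * R < (k + 1) * R' := h1
            _ ≤ (k + 1) * (k * (v - u)) := Nat.mul_le_mul_left _ hgap
            _ = k * ((k + 1) * (v - u)) := by ring
        exact (Nat.lt_of_mul_lt_mul_left h2).le
      · by_cases hxR : x = R
        · exact Or.inr (hxR ▸ (hvR'.trans hR'lt.le))
        · exact hall x (Finset.mem_erase.2 ⟨hxR, hx⟩)

/-- **The gap among `n` distances**: for `d : Fin n → ℕ` with `R = max d > 0` there are `u < v ≤ R` with
`R ≤ n (v − u)` and every `d i ≤ u` or `≥ v` (apply `exists_gap_aux` to `{0} ∪ range d`). [folklore] -/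
theorem exists_gap {n : ℕ} (d : Fin n → ℕ) {R : ℕ} (hR : ∀ i, d i ≤ R) (hex : ∃ i, d i = R) (hpos : 0 < R) :
    ∃ u v : ℕ, u < v ∧ v ≤ R ∧ R ≤ n * (v - u) ∧ ∀ i, d i ≤ u ∨ v ≤ d i := by
  classical
  set V : Finset ℕ := insert 0 ((Finset.univ : Finset (Fin n)).image d) with hV
  have hcardle : V.card ≤ n + 1 := by
    calc V.card ≤ ((Finset.univ : Finset (Fin n)).image d).card + 1 := Finset.card_insert_le _ _
      _ ≤ (Finset.univ : Finset (Fin n)).card + 1 := by gcongr; exact Finset.card_image_le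
      _ = n + 1 := by rw [Finset.card_univ, Fintype.card_fin]
  have h0 : 0 ∈ V := Finset.mem_insert_self _ _
  obtain ⟨i₀, hi₀⟩ := hex
  have hRV : R ∈ V := Finset.mem_insert_of_mem (Finset.mem_image.2 ⟨i₀, Finset.mem_univ _, hi₀⟩)
  have hmax : ∀ x ∈ V, x ≤ R := by
    intro x hx
    rcases Finset.mem_insert.1 hx with rfl | hx
    · exact Nat.zero_le _
    · obtain ⟨i, -, rfl⟩ := Finset.mem_image.1 hx; exact hR i
  have hpos' : 0 < V.card := Finset.card_pos.2 ⟨0, h0⟩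
  obtain ⟨u, v, huv, hvR, hgap, hall⟩ :=
    exists_gap_aux (V.card - 1) V R (by omega) h0 hRV hmax hpos
  refine ⟨u, v, huv, hvR, hgap.trans (Nat.mul_le_mul_right _ (by omega)), fun i => ?_⟩
  exact hall (d i) (Finset.mem_insert_of_mem (Finset.mem_image.2 ⟨i, Finset.mem_univ _, rfl⟩))

/-! ### §2 Products of bounded Lipschitz cylinders (crude uniform constants) -/

/-- **Finite products of bounded Lipschitz cylinders** with uniform constant `K₀` and uniform bound `B₀ ≥ 1` are
Lipschitz cylinders on the union of the supports with constant `|T| K₀ B₀^{|T|}`, bounded by `B₀^{|T|}`. [folklore] -/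
theorem isLipschitzCylinder_prod {d N : ℕ} {ι : Type*} [DecidableEq ι] [DecidableEq (ZdEdge d)]
    {X : ι → LGConfig d (Matrix.specialUnitaryGroup (Fin N) ℂ) → ℝ} {Λ : ι → Finset (ZdEdge d)} {K₀ B₀ : ℝ≥0}
    (hB : 1 ≤ B₀) (T : Finset ι) (hX : ∀ i ∈ T, IsLipschitzCylinder (fundamentalRep (Fin N)) (X i) (Λ i) K₀)
    (hM : ∀ i ∈ T, ∀ U, |X i U| ≤ B₀) :
    IsLipschitzCylinder (fundamentalRep (Fin N)) (fun U => ∏ i ∈ T, X i U) (T.biUnion Λ)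
        (T.card * K₀ * B₀ ^ T.card) ∧ ∀ U, |∏ i ∈ T, X i U| ≤ ((B₀ ^ T.card : ℝ≥0) : ℝ) := by
  induction T using Finset.induction_on with
  | empty =>
    refine ⟨?_, fun U => by simp⟩
    refine ZdSmoothing.isLipschitzCylinder_of_dist_le fun U V => ?_
    simp
  | insert i T hi ih =>
    obtain ⟨h1, h2⟩ := ih (fun j hj => hX j (Finset.mem_insert_of_mem hj)) (fun j hj => hM j (Finset.mem_insert_of_mem hj))
    have hXi := hX i (Finset.mem_insert_self i T)
    have hMi := hM i (Finset.mem_insert_self i T)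
    have hmul := isLipschitzCylinder_mul hXi h1 hMi h2
    refine ⟨?_, fun U => ?_⟩
    · have e : (fun U => ∏ j ∈ insert i T, X j U) = fun U => X i U * ∏ j ∈ T, X j U := by
        funext U; rw [Finset.prod_insert hi]
      rw [e, Finset.biUnion_insert]
      refine ZdSmoothing.isLipschitzCylinder_mono hmul ?_
      rw [Finset.card_insert_of_notMem hi]
      have hB' : (B₀ : ℝ) ≥ 1 := by exact_mod_cast hB
      have hK : (0 : ℝ) ≤ K₀ := K₀.2
      rw [← NNReal.coe_le_coe]
      push_cast
      have hT : (0 : ℝ) ≤ T.card := Nat.cast_nonneg _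
      have hpow : (0 : ℝ) ≤ (B₀ : ℝ) ^ T.card := by positivity
      have key : (K₀ : ℝ) * (B₀ : ℝ) ^ T.card ≤ (K₀ : ℝ) * (B₀ : ℝ) ^ T.card * B₀ :=
        le_mul_of_one_le_right (mul_nonneg hK hpow) hB'
      rw [pow_succ]
      nlinarith [key, mul_nonneg (mul_nonneg hT hK) hpow]
    · rw [Finset.prod_insert hi, abs_mul, Finset.card_insert_of_notMem hi]
      push_cast
      rw [pow_succ, mul_comm ((B₀ : ℝ) ^ T.card)]
      have h2U := h2 U
      push_cast at h2U
      exact mul_le_mul (hMi U) h2U (abs_nonneg _) (zero_le_one.trans (by exact_mod_cast hB))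

/-! ### §3 Geometric plaquette sums and tuple series -/

/-- `∏_i ρ^{ℓ_i} = exp(−c Σ_i ℓ_i)` for `ρ = e^{−c}`. [folklore] -/
theorem prod_exp_neg_pow_eq {n : ℕ} (c : ℝ) (ℓ : Fin n → ℕ) :
    ∏ i, Real.exp (-c) ^ ℓ i = Real.exp (-(c * ∑ i, (ℓ i : ℝ))) := by
  rw [Finset.mul_sum, ← Finset.sum_neg_distrib, Real.exp_sum]
  refine Finset.prod_congr rfl fun i _ => ?_
  rw [← Real.exp_nat_mul]; congr 1; ring

/-- Finite sums of the geometric lattice weights `ρ^{‖x₀ − x_r‖₁}` over plaquettes are bounded by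
`Z = D₄((1+ρ)/(1−ρ))⁴` (rb-p1's `summable_and_tsum_base_le`). -/
theorem sum_pow_l1_plaquette_le {ρ : ℝ} (hρ0 : 0 ≤ ρ) (hρ1 : ρ < 1) (x₀ : Site 4) (s : Finset (ZdPlaquette 4)) :
    ∑ r ∈ s, ρ ^ l1 (x₀ - r.1) ≤ numOrient 4 * ((1 + ρ) / (1 - ρ)) ^ 4 := by
  obtain ⟨hs, hle⟩ := summable_and_tsum_base_le (d := 4) (c := 1) zero_le_one hρ0 hρ1 x₀
  simp only [one_mul] at hs hle
  exact (hs.sum_le_tsum s fun r _ => pow_nonneg hρ0 _).trans hle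

/-- **Re-indexing `(n+1)`-tuples** as (`n`-tuple, last entry): `Σ'_{q'} f q' = Σ'_q Σ'_r f (snoc q r)` for a summable
`f` (`Fin.snocEquiv` and `Summable.tsum_prod`). [folklore] -/
theorem tsum_snoc_eq {P : Type*} {n : ℕ} {f : (Fin (n + 1) → P) → ℝ} (hf : Summable f) :
    ∑' q' : Fin (n + 1) → P, f q' = ∑' q : Fin n → P, ∑' r : P, f (Fin.snoc q r) := by
  set e : (Fin n → P) × P ≃ (Fin (n + 1) → P) := (Equiv.prodComm _ _).trans (Fin.snocEquiv fun _ => P) with he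
  have he' : ∀ x : (Fin n → P) × P, e x = Fin.snoc x.1 x.2 := fun x => rfl
  rw [← e.tsum_eq f]
  simp only [he']
  exact (show Summable fun x : (Fin n → P) × P => f (Fin.snoc x.1 x.2) from by
    have h := e.summable_iff.2 hf
    simpa [Function.comp_def, he'] using h).tsum_prod

end Summit.Ventures.YMGap.CouplingResponse

end
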